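import Summits.AtomisticToContinuum.HydrodynamicLimit.Theorems.ImplosionDichotomyHydroLimitInBandSignedInputs
import Summits.AtomisticToContinuum.HydrodynamicLimit.Theorems.ImplosionDichotomyProfilewiseOfInBand
import HarnessLib

/-!
# `HydroLimitProfilewiseBand` from the five inputs of the SIGNED-band line (glue, `--supports stmt-AtomisticToContinuum-17372`)

Line `IdeatorOneSketch` of the crux `ImplosionDichotomy.HydroLimitProfilewiseBand` (stmt-17372), skeleton v12 (lead c7, line cycle 8):
after the refutation of `BandCoherenceLDAlongFamilies` (stmt-17700, p145064) both this crux and its sibling `HydroLimitInBand`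
(stmt-9133) were re-threaded around it (repair R1, signed band remainder); the four provable stubs of the reshape are LANDED
(`stub_cubicChannelRateS` p146424, `stub_kineticInstanceOrth` p146924, `stub_windowClauseRateS` p146888, `stub_bandShiftStatics`
p147261 — core also p146899) and the sibling's glue `HydroLimitInBandSignedBand.hydroLimitInBand_of_signedInputs` (p148646) takes the
FIVE remaining conjecture-grade inputs to `HydroLimitInBand`. This file composes it with the landed `profilewiseOfInBand_proof`
(stmt-17373, p131525): the `--glue-by` declaration for a planner who splits THIS crux onto SEET (stmt-17701), KCWF-Q
(`HydroLimitInBandSignedBand.KineticCurrentsLDAlongFamiliesQ`, to be filed as the item replacing 17700; implies KCWF 16659),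
LCTF (stmt-17691), EAT (stmt-17703), CAT (stmt-13734). Registered support sub-goal `hydroLimitProfilewiseBand_of_signedInputs`.
-/

namespace Summit.AtomisticToContinuum.HydrodynamicLimit.Theorems.HydroLimitProfilewiseBandSignedGlue

open Summit.AtomisticToContinuum.HydrodynamicLimit.Theses
open Summit.AtomisticToContinuum.HydrodynamicLimit.Theorems
open Summit.AtomisticToContinuum.HydrodynamicLimit.Theorems.HydroLimitInBandSignedBand (KineticCurrentsLDAlongFamiliesQ
  hydroLimitInBand_of_signedInputs)

/-- **`HydroLimitProfilewiseBand` (stmt-17372) from the five inputs of the signed-band line** — SEET (stmt-17701), KCWF-Q (the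
kinetic-currents window LD along families with a class-uniform tilt threshold), LCTF (stmt-17691), EAT (stmt-17703), CAT (stmt-13734):
the sibling's landed `hydroLimitInBand_of_signedInputs` (p148646: Yau's relative entropy along the explicit clamped reference family, the
signed cubic channel, the D-shape one-window ledger, the guarded Grönwall core, reduction and dock) followed by the landed
`profilewiseOfInBand_proof` (∃∀ ⇒ ∀∃, p131525). The `--glue-by` declaration for splitting stmt-17372 onto those five statements.
[folklore] -/
theorem hydroLimitProfilewiseBand_of_signedInputs (hS : OneFlightGossipEngine.SuperExponentialEnergyTails)
    (hQ : KineticCurrentsLDAlongFamiliesQ) (hL : OneFlightGossipEngine.LocalClampedTransferLDAlongFamilies)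
    (hE : OneFlightGossipEngine.EnergyActivityTails) (hC : OneFlightGossipEngine.CollisionActivityTails) :
    ImplosionDichotomy.HydroLimitProfilewiseBand :=
  profilewiseOfInBand_proof (hydroLimitInBand_of_signedInputs hS hQ hL hE hC)

end Summit.AtomisticToContinuum.HydrodynamicLimit.Theorems.HydroLimitProfilewiseBandSignedGlue
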